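import Literature.MathematicalPhysics.QuantumManyBody.SwapPurity
import Mathlib.MeasureTheory.Measure.Decomposition.RadonNikodym
import Mathlib.MeasureTheory.Integral.MeanInequalities
import HarnessLib

/-!
# One-particle marginals of an `N`-body wave function: density, density matrix, Palm laws,
# Hellinger affinity

Topic `Literature/MathematicalPhysics/QuantumManyBody` (definition item `defn-groundState`,
second file; companion of `GroundState.lean`, of
`Literature.MathematicalPhysics.QuantumManyBody.BoseGas` in `BoseEinsteinCondensation.lean`
(whose `Space`, `Config`, `occupation`, `maxOccupation` it complements) and of `SwapPurity.lean`
(imported for the `Matrix.vecCons` splitting lemmas; its `swapPurity = tr(γ_Ψ²)/N²` is the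
Hilbert–Schmidt functional of the same `γ_Ψ`). Everything here is
about an ARBITRARY `N = n + 1`-body function `Ψ : (ℝ³)^N → ℂ` (in the applications the ground
state `groundState v N L` of `GroundState.lean`, or a near-minimising trial state); wanted by
route `EqualScatteringTransfer` (children `NeutralDressingOscillation`, `AffinityTransfer`,
`AffinityGlue` of the crux `CondensateComparison`) and by the Palm–Hellinger idea cards.

## Content

Write `X = (x, Y)`, `Y = (x₂, …, x_N) ∈ (ℝ³)^n`, `(x, Y) = Matrix.vecCons x Y`.

* `lintegral_lintegral_vecCons` — Tonelli for splitting off the first particle,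
  `∫ (∫ F(x, Y) dY) dx = ∫ F dX` (`MeasurableEquiv.piFinSuccAbove`, volume preserving; the
  splitting lemmas `piFinSuccAbove_symm_apply_eq_vecCons`, `measurable_vecCons` of
  `SwapPurity.lean` are reused — its `lintegral_config_succ` is the same Tonelli with `x`
  innermost — and `measurable_vecCons_right` is the section at fixed `x`).
* `sliceMass Ψ x = ∫ |Ψ(x, Y)|² dY` and the **one-particle density**
  `oneParticleDensity N Ψ x = ρ_Ψ(x) = γ_Ψ(x, x) = N ∫ |Ψ(x, Y)|² dY` with
  `∫ ρ_Ψ = N ∫ |Ψ|²` (`lintegral_oneParticleDensity`; "tr γ = N", LSSY after (1.18)).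
* `palmDensity Ψ x Y = |Ψ(x, Y)|² / ∫ |Ψ(x, Y')|² dY'` and the **Palm measure** `palmMeasure Ψ x`
  on `(ℝ³)^n`: the conditional law of the other particles given a particle at `x` under
  `|Ψ|² dX` (for Bose-symmetric `Ψ`, the reduced Palm distribution of the finite point process
  `{x₁, …, x_N}`); a probability measure when `0 < sliceMass Ψ x < ∞`
  (`isProbabilityMeasure_palmMeasure`), the ZERO measure otherwise (documented junk:
  `palmMeasure_of_sliceMass_eq_zero`, `palmMeasure_of_sliceMass_eq_top`); `palmMeasure_apply`.
* `affinity π μ ν = ∫ √(dμ/dπ · dν/dπ) dπ ∈ [0, ∞]` — the Bhattacharyya–Hellinger affinity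
  (Hellinger transform at `α = 1/2`, Ghosal–van der Vaart (B.5)) relative to a reference measure `π`; symmetric
  (`affinity_comm`), `= ∫ √(pq) dπ` for densities (`affinity_withDensity`), `= ∫ p` on the
  diagonal (`affinity_withDensity_self`), Cauchy–Schwarz `A(μ, ν) ≤ μ(univ)^{1/2} ν(univ)^{1/2}`
  (`affinity_le`).
* **Affinity representation** (proved): for positive finite slice masses at `x, y`,
  `√(Zₓ Z_y) · A(Pₓ, P_y) = ∫ |Ψ(x, Y)| |Ψ(y, Y)| dY` (`sqrt_sliceMass_mul_affinity_palmMeasure`)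
  and `√(ρ_Ψ(x) ρ_Ψ(y)) · A(Pₓ, P_y) = N ∫ |Ψ(x, Y)| |Ψ(y, Y)| dY`
  (`sqrt_oneParticleDensity_mul_affinity_palmMeasure`).
* `densityMatrix N Ψ x y = γ_Ψ(x, y) = N ∫ Ψ(x, Y) conj Ψ(y, Y) dY` — the one-particle density
  matrix kernel (LSSY (1.17); Bochner integral), and for a real NONNEGATIVE state (the ground
  state) `γ(x, y) = N ∫ Ψ₀(x, Y) Ψ₀(y, Y) dY` read off the `[0, ∞]`-valued overlap
  (`densityMatrix_ofReal_eq`), so that `γ(x, y) = √(ρ(x) ρ(y)) · A(Pₓ, P_y)` for `Ψ₀ ≥ 0`: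
  off-diagonal long-range order of a positive ground state is an affinity of its Palm laws.

## Design choices / what is NOT here

* FACT-FREE (no named facts). `ℝ≥0∞`-valued integrals (no integrability side conditions)
  except for the complex kernel `densityMatrix`, whose Bochner integral carries Mathlib's junk
  `0` where `Y ↦ Ψ(x, Y) conj Ψ(y, Y)` is not integrable (it is integrable for a.e. `(x, y)` when
  `Ψ ∈ L²`); `densityMatrix_ofReal_eq` holds with matching junk on both sides.
* The tagged particle is the FIRST coordinate (`Matrix.vecCons`), as in `occupation`; for
  symmetric `Ψ` nothing depends on this choice.
* `affinity` takes the reference measure explicitly (here always Lebesgue measure on `(ℝ³)^n`);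
  its independence of `π ≫ μ, ν` and the relation `H² = 1 - A` to the Hellinger distance are not
  needed and not formalised. Mathlib has `Measure.rnDeriv`, `withDensity`, Hölder
  (`ENNReal.lintegral_mul_le_Lp_mul_Lq`) but no Hellinger/Bhattacharyya affinity and no reduced
  density matrices (searched `hellinger`, `Bhattacharyya`, `affinity`, `densityMatrix`).
* Not here: `γ_Ψ` as a trace-class operator, its spectrum, `⟨φ, γ φ⟩ = occupation N φ Ψ` as a
  theorem (it is the definition of `occupation` up to Fubini), Palm theory of point processes.

## References

* [LSSY2005] E. H. Lieb, R. Seiringer, J. P. Solovej, J. Yngvason, *The Mathematics of the Bose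
  Gas and its Condensation* (2005), §1.2 (1.17)–(1.19): `γ(x, x') = N ∫ Ψ₀(x, X) Ψ₀(x', X) dX`,
  `∫ γ(x, x) dx = tr γ = N`.
* [GhosalVandervaart2017] S. Ghosal, A. van der Vaart, *Fundamentals of Nonparametric Bayesian
  Inference*, CUP 2017, App. B.2 (B.5)–(B.7) and Lemma B.5 (Hellinger transform
  `ρ_α(p; q) = ∫ p^α q^{1-α} dν`; `α = 1/2` "is also called affinity"; bounded by one for
  probability densities by Hölder).
* S. Kakutani, *On equivalence of infinite product measures*, Ann. of Math. 49 (1948) 214–224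
  (origin of the Hellinger integral; not consulted, paywalled — acquisition request filed).
-/

noncomputable section

open MeasureTheory Filter Metric
open scoped ENNReal NNReal ComplexConjugate Topology

namespace Literature.MathematicalPhysics.QuantumManyBody.BoseGas

/-! ### One-particle marginals of an `N`-body function: slices, density, Palm laws -/

section OneParticle

variable {n : ℕ}

/-- Inserting the tagged particle at a fixed position, `Y ↦ (x, Y)`, is measurable (section of the
jointly measurable `measurable_vecCons` of `SwapPurity.lean`). [folklore] -/
theorem measurable_vecCons_right (x : Space) :
    Measurable fun Y : Config n => (Matrix.vecCons x Y : Config (n + 1)) :=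
  measurable_vecCons.comp (measurable_const.prodMk measurable_id)

/-- **Integrating out the first particle** (Tonelli on `(ℝ³)^{n+1} ≅ ℝ³ × (ℝ³)^n`):
`∫ (∫ F(x, Y) dY) dx = ∫ F(X) dX` for measurable `F ≥ 0`. [folklore] -/
theorem lintegral_lintegral_vecCons {F : Config (n + 1) → ℝ≥0∞} (hF : Measurable F) :
    ∫⁻ x, ∫⁻ Y, F (Matrix.vecCons x Y) = ∫⁻ X, F X := by
  set e := MeasurableEquiv.piFinSuccAbove (fun _ : Fin (n + 1) => Space) 0 with he
  have hmp : MeasurePreserving e.symm (volume.prod volume) volume :=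
    (volume_preserving_piFinSuccAbove (fun _ : Fin (n + 1) => Space) 0).symm
  calc ∫⁻ x, ∫⁻ Y, F (Matrix.vecCons x Y) = ∫⁻ x, ∫⁻ Y, F (e.symm (x, Y)) := by
        simp only [he, piFinSuccAbove_symm_apply_eq_vecCons]
    _ = ∫⁻ z, F (e.symm z) ∂(volume.prod volume) :=
        (lintegral_prod _ (hF.comp e.symm.measurable).aemeasurable).symm
    _ = ∫⁻ X, F X := hmp.lintegral_comp_emb e.symm.measurableEmbedding F

/-- The **slice mass** `∫ |Ψ(x, Y)|² dY ∈ [0, ∞]` of the `(n+1)`-body function `Ψ` at the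
tagged position `x` (so that `γ_Ψ(x, x) = N · sliceMass Ψ x`). [cite: LSSY2005, §1.2 (1.17)–(1.18)] -/
def sliceMass (Ψ : Config (n + 1) → ℂ) (x : Space) : ℝ≥0∞ :=
  ∫⁻ Y : Config n, (‖Ψ (Matrix.vecCons x Y)‖₊ : ℝ≥0∞) ^ 2

/-- The slice `Y ↦ |Ψ(x, Y)|²` is measurable. [folklore] -/
theorem measurable_nnnorm_vecCons_sq {Ψ : Config (n + 1) → ℂ} (hΨ : Measurable Ψ) (x : Space) :
    Measurable fun Y : Config n => (‖Ψ (Matrix.vecCons x Y)‖₊ : ℝ≥0∞) ^ 2 :=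
  (hΨ.comp (measurable_vecCons_right x)).nnnorm.coe_nnreal_ennreal.pow_const 2

/-- `x ↦ sliceMass Ψ x` is measurable. [folklore] -/
theorem measurable_sliceMass {Ψ : Config (n + 1) → ℂ} (hΨ : Measurable Ψ) :
    Measurable (sliceMass Ψ) := by
  have hF : Measurable fun z : Space × Config n =>
      (‖Ψ ((MeasurableEquiv.piFinSuccAbove (fun _ : Fin (n + 1) => Space) 0).symm z)‖₊ :
        ℝ≥0∞) ^ 2 :=
    (hΨ.comp (MeasurableEquiv.measurable _)).nnnorm.coe_nnreal_ennreal.pow_const 2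
  have h2 : Measurable fun x : Space => ∫⁻ Y : Config n,
      (‖Ψ ((MeasurableEquiv.piFinSuccAbove (fun _ : Fin (n + 1) => Space) 0).symm (x, Y))‖₊ :
        ℝ≥0∞) ^ 2 :=
    hF.lintegral_prod_right'
  simp only [piFinSuccAbove_symm_apply_eq_vecCons] at h2
  exact h2

/-- **Total slice mass**: `∫ sliceMass Ψ x dx = ∫ |Ψ|²` (`= 1` for a normalised state).
[cite: LSSY2005, §1.2 (after (1.18))] -/
theorem lintegral_sliceMass {Ψ : Config (n + 1) → ℂ} (hΨ : Measurable Ψ) :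
    ∫⁻ x, sliceMass Ψ x = ∫⁻ X, (‖Ψ X‖₊ : ℝ≥0∞) ^ 2 :=
  lintegral_lintegral_vecCons (F := fun X => (‖Ψ X‖₊ : ℝ≥0∞) ^ 2)
    (hΨ.nnnorm.coe_nnreal_ennreal.pow_const 2)

/-- The **one-particle density** `ρ_Ψ(x) = γ_Ψ(x, x) = N ∫ |Ψ(x, Y)|² dY ∈ [0, ∞]` of the `N`-body
function `Ψ` (`0` for `N = 0`). [cite: LSSY2005, §1.2 (1.17)–(1.18)] -/
def oneParticleDensity : (N : ℕ) → (Config N → ℂ) → Space → ℝ≥0∞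
  | 0, _, _ => 0
  | n + 1, Ψ, x => (n + 1 : ℝ≥0∞) * sliceMass Ψ x

/-- `∫ ρ_Ψ = N ∫ |Ψ|²`, i.e. `tr γ_Ψ = N` for a normalised `Ψ`. [cite: LSSY2005, §1.2 (after (1.18))] -/
theorem lintegral_oneParticleDensity {Ψ : Config (n + 1) → ℂ} (hΨ : Measurable Ψ) :
    ∫⁻ x, oneParticleDensity (n + 1) Ψ x = (n + 1 : ℝ≥0∞) * ∫⁻ X, (‖Ψ X‖₊ : ℝ≥0∞) ^ 2 := by
  simp only [oneParticleDensity]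
  rw [lintegral_const_mul _ (measurable_sliceMass hΨ), lintegral_sliceMass hΨ]

/-- The **Palm (conditional) density** of the other particles given a particle at `x`:
`p_x(Y) = |Ψ(x, Y)|² / ∫ |Ψ(x, Y')|² dY'` (`ℝ≥0∞` arithmetic: `⊤ · |Ψ(x,Y)|²` if the slice mass
vanishes, `0` if it is infinite). [folklore] -/
def palmDensity (Ψ : Config (n + 1) → ℂ) (x : Space) (Y : Config n) : ℝ≥0∞ :=
  (sliceMass Ψ x)⁻¹ * (‖Ψ (Matrix.vecCons x Y)‖₊ : ℝ≥0∞) ^ 2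

/-- The **Palm measure** `P_x` of the `(n+1)`-body function `Ψ` at `x`: the law of
`Y = (x₂, …, x_N) ∈ (ℝ³)^n` with Lebesgue density `|Ψ(x, Y)|² / ∫ |Ψ(x, Y')|² dY'`, i.e. the
conditional distribution of the remaining particles under `|Ψ|² dX` given that the tagged particle
sits at `x`. A probability measure when `0 < sliceMass Ψ x < ∞`
(`isProbabilityMeasure_palmMeasure`); the ZERO measure (junk) otherwise. [folklore] -/
def palmMeasure (Ψ : Config (n + 1) → ℂ) (x : Space) : Measure (Config n) :=
  volume.withDensity (palmDensity Ψ x)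

/-- The Palm density is measurable in `Y`. [folklore] -/
theorem measurable_palmDensity {Ψ : Config (n + 1) → ℂ} (hΨ : Measurable Ψ) (x : Space) :
    Measurable (palmDensity Ψ x) :=
  (measurable_nnnorm_vecCons_sq hΨ x).const_mul _

/-- The Palm density integrates to `1` when the slice mass is positive and finite. [folklore] -/
theorem lintegral_palmDensity {Ψ : Config (n + 1) → ℂ} (hΨ : Measurable Ψ) {x : Space}
    (h0 : sliceMass Ψ x ≠ 0) (ht : sliceMass Ψ x ≠ ⊤) : ∫⁻ Y, palmDensity Ψ x Y = 1 := by
  simp only [palmDensity]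
  rw [lintegral_const_mul _ (measurable_nnnorm_vecCons_sq hΨ x)]
  exact ENNReal.inv_mul_cancel h0 ht

/-- `P_x(s) = (∫_s |Ψ(x, Y)|² dY) / ∫ |Ψ(x, Y)|² dY`. [folklore] -/
theorem palmMeasure_apply {Ψ : Config (n + 1) → ℂ} (hΨ : Measurable Ψ) (x : Space)
    {s : Set (Config n)} (hs : MeasurableSet s) :
    palmMeasure Ψ x s =
      (sliceMass Ψ x)⁻¹ * ∫⁻ Y in s, (‖Ψ (Matrix.vecCons x Y)‖₊ : ℝ≥0∞) ^ 2 := by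
  rw [palmMeasure, withDensity_apply _ hs]
  simp only [palmDensity]
  rw [lintegral_const_mul _ (measurable_nnnorm_vecCons_sq hΨ x)]

/-- For `0 < sliceMass Ψ x < ∞` the Palm measure is a probability measure. [folklore] -/
theorem isProbabilityMeasure_palmMeasure {Ψ : Config (n + 1) → ℂ} (hΨ : Measurable Ψ)
    {x : Space} (h0 : sliceMass Ψ x ≠ 0) (ht : sliceMass Ψ x ≠ ⊤) :
    IsProbabilityMeasure (palmMeasure Ψ x) :=
  ⟨by rw [palmMeasure, withDensity_apply _ MeasurableSet.univ, Measure.restrict_univ,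
    lintegral_palmDensity hΨ h0 ht]⟩

/-- Junk case: infinite slice mass gives the zero measure. [folklore] -/
theorem palmMeasure_of_sliceMass_eq_top {Ψ : Config (n + 1) → ℂ} {x : Space}
    (h : sliceMass Ψ x = ⊤) : palmMeasure Ψ x = 0 := by
  have : palmDensity Ψ x = 0 := by
    funext Y
    simp [palmDensity, h]
  rw [palmMeasure, this, withDensity_zero]

/-- Junk case: zero slice mass (`Ψ(x, ·) = 0` a.e.) gives the zero measure. [folklore] -/
theorem palmMeasure_of_sliceMass_eq_zero {Ψ : Config (n + 1) → ℂ} (hΨ : Measurable Ψ)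
    {x : Space} (h : sliceMass Ψ x = 0) : palmMeasure Ψ x = 0 := by
  have hae : (fun Y => (‖Ψ (Matrix.vecCons x Y)‖₊ : ℝ≥0∞) ^ 2) =ᵐ[volume] 0 :=
    (lintegral_eq_zero_iff (measurable_nnnorm_vecCons_sq hΨ x)).1 h
  have hd : palmDensity Ψ x =ᵐ[volume] 0 := by
    filter_upwards [hae] with Y hY
    simp only [palmDensity, hY, Pi.zero_apply, mul_zero]
  rw [palmMeasure, withDensity_congr_ae hd, withDensity_zero]

end OneParticle

/-! ### Bhattacharyya–Hellinger affinity and the affinity form of the density matrix -/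

section Affinity

variable {α : Type*} [MeasurableSpace α]

/-- The **Bhattacharyya–Hellinger affinity** `A(μ, ν) = ∫ √(dμ/dπ · dν/dπ) dπ ∈ [0, ∞]` of two
measures relative to a reference measure `π`: the Hellinger transform `ρ_α(p; q) = ∫ p^α q^{1-α} dν`
at `α = 1/2` ("also called affinity"), going back to Kakutani's Hellinger integral; independent of
`π` as long as `μ, ν ≪ π`. Here with explicit `π`, Radon–Nikodym derivatives `Measure.rnDeriv`
and `√· = (·)^{1/2}` on `ℝ≥0∞`.
[cite: GhosalVandervaart2017, App. B.2 (B.5)] -/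
def affinity (π μ ν : Measure α) : ℝ≥0∞ :=
  ∫⁻ a, (μ.rnDeriv π a * ν.rnDeriv π a) ^ (2⁻¹ : ℝ) ∂π

/-- The affinity is symmetric. [cite: GhosalVandervaart2017, App. B.2 (B.5)] -/
theorem affinity_comm (π μ ν : Measure α) : affinity π μ ν = affinity π ν μ := by
  simp only [affinity, mul_comm]

/-- For measures given by densities, `A(p π, q π) = ∫ √(p q) dπ`. [cite: GhosalVandervaart2017, App. B.2 (B.5)] -/
theorem affinity_withDensity (π : Measure α) [SigmaFinite π] {p q : α → ℝ≥0∞}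
    (hp : AEMeasurable p π) (hq : AEMeasurable q π) :
    affinity π (π.withDensity p) (π.withDensity q) = ∫⁻ a, (p a * q a) ^ (2⁻¹ : ℝ) ∂π := by
  refine lintegral_congr_ae ?_
  filter_upwards [Measure.rnDeriv_withDensity₀ π hp, Measure.rnDeriv_withDensity₀ π hq]
    with a ha hb
  rw [ha, hb]

/-- On the diagonal the affinity of the measure with density `p` is its total mass `∫ p dπ`
(`A(P, P) = 1` for a probability density). [cite: GhosalVandervaart2017, App. B.2 (B.5)] -/
theorem affinity_withDensity_self (π : Measure α) [SigmaFinite π] {p : α → ℝ≥0∞}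
    (hp : AEMeasurable p π) :
    affinity π (π.withDensity p) (π.withDensity p) = ∫⁻ a, p a ∂π := by
  rw [affinity_withDensity π hp hp]
  refine lintegral_congr fun a => ?_
  rw [← sq]
  have h := ENNReal.pow_rpow_inv_natCast two_ne_zero (p a)
  rwa [Nat.cast_ofNat] at h

/-- **Cauchy–Schwarz for the affinity**: `A(μ, ν) ≤ μ(univ)^{1/2} ν(univ)^{1/2}`; in particular
`A ≤ 1` for (sub-)probability measures ("bounded by one for probability densities, by Hölder's
inequality"). [cite: GhosalVandervaart2017, App. B.2 (after (B.7))] -/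
theorem affinity_le (π μ ν : Measure α) :
    affinity π μ ν ≤ μ Set.univ ^ (2⁻¹ : ℝ) * ν Set.univ ^ (2⁻¹ : ℝ) := by
  have hf : AEMeasurable (fun a => μ.rnDeriv π a ^ (2⁻¹ : ℝ)) π :=
    ((Measure.measurable_rnDeriv μ π).pow_const _).aemeasurable
  have hg : AEMeasurable (fun a => ν.rnDeriv π a ^ (2⁻¹ : ℝ)) π :=
    ((Measure.measurable_rnDeriv ν π).pow_const _).aemeasurable
  have hH := ENNReal.lintegral_mul_le_Lp_mul_Lq π Real.HolderConjugate.two_two hf hg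
  simp only [Pi.mul_apply, ENNReal.rpow_inv_rpow (two_ne_zero' ℝ), one_div] at hH
  calc affinity π μ ν = ∫⁻ a, μ.rnDeriv π a ^ (2⁻¹ : ℝ) * ν.rnDeriv π a ^ (2⁻¹ : ℝ) ∂π := by
        simp only [affinity, ENNReal.mul_rpow_of_nonneg _ _ (by norm_num : (0 : ℝ) ≤ 2⁻¹)]
    _ ≤ (∫⁻ a, μ.rnDeriv π a ∂π) ^ (2⁻¹ : ℝ) * (∫⁻ a, ν.rnDeriv π a ∂π) ^ (2⁻¹ : ℝ) := hH
    _ ≤ μ Set.univ ^ (2⁻¹ : ℝ) * ν Set.univ ^ (2⁻¹ : ℝ) := by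
        exact mul_le_mul' (ENNReal.rpow_le_rpow Measure.lintegral_rnDeriv_le (by norm_num))
          (ENNReal.rpow_le_rpow Measure.lintegral_rnDeriv_le (by norm_num))

variable {n : ℕ}

/-- **Affinity representation, slice form.** For an `(n+1)`-body function `Ψ` and tagged
positions `x, y` with positive finite slice masses `Zₓ, Z_y`:
`√(Zₓ Z_y) · A(Pₓ, P_y) = ∫ |Ψ(x, Y)| |Ψ(y, Y)| dY` — the Bhattacharyya coefficient of the Palm laws
is the normalised overlap of the slices. [folklore] -/
theorem sqrt_sliceMass_mul_affinity_palmMeasure {Ψ : Config (n + 1) → ℂ} (hΨ : Measurable Ψ)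
    {x y : Space} (hx0 : sliceMass Ψ x ≠ 0) (hxt : sliceMass Ψ x ≠ ⊤)
    (hy0 : sliceMass Ψ y ≠ 0) (hyt : sliceMass Ψ y ≠ ⊤) :
    (sliceMass Ψ x * sliceMass Ψ y) ^ (2⁻¹ : ℝ) *
        affinity volume (palmMeasure Ψ x) (palmMeasure Ψ y) =
      ∫⁻ Y, (‖Ψ (Matrix.vecCons x Y)‖₊ : ℝ≥0∞) * ‖Ψ (Matrix.vecCons y Y)‖₊ := by
  rw [palmMeasure, palmMeasure, affinity_withDensity volume
    (measurable_palmDensity hΨ x).aemeasurable (measurable_palmDensity hΨ y).aemeasurable]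
  -- `(a²)^{1/2} = a` on `[0, ∞]` (Mathlib's `ENNReal.pow_rpow_inv_natCast` at `n = 2`)
  have hsq : ∀ a : ℝ≥0∞, (a ^ 2) ^ (2⁻¹ : ℝ) = a := fun a => by
    have h := ENNReal.pow_rpow_inv_natCast two_ne_zero a
    rwa [Nat.cast_ofNat] at h
  have hpt : ∀ Y, (palmDensity Ψ x Y * palmDensity Ψ y Y) ^ (2⁻¹ : ℝ) =
      ((sliceMass Ψ x)⁻¹ * (sliceMass Ψ y)⁻¹) ^ (2⁻¹ : ℝ) *
        ((‖Ψ (Matrix.vecCons x Y)‖₊ : ℝ≥0∞) * ‖Ψ (Matrix.vecCons y Y)‖₊) := by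
    intro Y
    simp only [palmDensity]
    rw [mul_mul_mul_comm, ENNReal.mul_rpow_of_nonneg _ _ (by norm_num : (0 : ℝ) ≤ 2⁻¹),
      ← mul_pow, hsq]
  simp_rw [hpt]
  have hmeas : Measurable fun Y : Config n =>
      (‖Ψ (Matrix.vecCons x Y)‖₊ : ℝ≥0∞) * ‖Ψ (Matrix.vecCons y Y)‖₊ :=
    (hΨ.comp (measurable_vecCons_right x)).nnnorm.coe_nnreal_ennreal.mul
      (hΨ.comp (measurable_vecCons_right y)).nnnorm.coe_nnreal_ennreal
  rw [lintegral_const_mul _ hmeas, ← mul_assoc, ← ENNReal.mul_rpow_of_nonneg _ _ (by norm_num : (0 : ℝ) ≤ 2⁻¹),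
    mul_mul_mul_comm, ENNReal.mul_inv_cancel hx0 hxt, ENNReal.mul_inv_cancel hy0 hyt, one_mul,
    ENNReal.one_rpow, one_mul]

/-- **Affinity representation of the one-particle density matrix of a nonnegative state**
(LSSY (1.17) rewritten through the Palm laws): with `ρ = oneParticleDensity`,
`√(ρ_Ψ(x) ρ_Ψ(y)) · A(Pₓ, P_y) = N ∫ |Ψ(x, Y)| |Ψ(y, Y)| dY`, which for real `Ψ ≥ 0` is
`γ_Ψ(x, y)` (`densityMatrix_ofReal_eq`). Requires positive finite slice masses at `x` and `y`.
[cite: LSSY2005, §1.2 (1.17)] -/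
theorem sqrt_oneParticleDensity_mul_affinity_palmMeasure {Ψ : Config (n + 1) → ℂ}
    (hΨ : Measurable Ψ) {x y : Space} (hx0 : sliceMass Ψ x ≠ 0) (hxt : sliceMass Ψ x ≠ ⊤)
    (hy0 : sliceMass Ψ y ≠ 0) (hyt : sliceMass Ψ y ≠ ⊤) :
    (oneParticleDensity (n + 1) Ψ x * oneParticleDensity (n + 1) Ψ y) ^ (2⁻¹ : ℝ) *
        affinity volume (palmMeasure Ψ x) (palmMeasure Ψ y) =
      (n + 1 : ℝ≥0∞) * ∫⁻ Y, (‖Ψ (Matrix.vecCons x Y)‖₊ : ℝ≥0∞) * ‖Ψ (Matrix.vecCons y Y)‖₊ := by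
  have h1 : oneParticleDensity (n + 1) Ψ x * oneParticleDensity (n + 1) Ψ y =
      (n + 1 : ℝ≥0∞) ^ 2 * (sliceMass Ψ x * sliceMass Ψ y) := by
    simp only [oneParticleDensity]
    ring
  have hsq : ((n + 1 : ℝ≥0∞) ^ 2) ^ (2⁻¹ : ℝ) = n + 1 := by
    have h := ENNReal.pow_rpow_inv_natCast two_ne_zero (n + 1 : ℝ≥0∞)
    rwa [Nat.cast_ofNat] at h
  rw [h1, ENNReal.mul_rpow_of_nonneg _ _ (by norm_num : (0 : ℝ) ≤ 2⁻¹), hsq,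
    mul_assoc, sqrt_sliceMass_mul_affinity_palmMeasure hΨ hx0 hxt hy0 hyt]

end Affinity

/-! ### The one-particle density matrix kernel -/

section DensityMatrix

variable {n : ℕ}

/-- The **one-particle density matrix** kernel `γ_Ψ(x, y) = N ∫ Ψ(x, Y) conj(Ψ(y, Y)) dY` of an
`N`-body wave function `Ψ` (Bochner integral; `0` for `N = 0`, and the junk value `0` of the
Bochner integral where `Y ↦ Ψ(x, Y) conj Ψ(y, Y)` is not integrable — it is, for a.e. `(x, y)`,
when `Ψ ∈ L²`). Its diagonal is `ρ_Ψ` and `⟨φ, γ_Ψ φ⟩ = occupation N φ Ψ`.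
[cite: LSSY2005, §1.2 (1.17)] -/
def densityMatrix : (N : ℕ) → (Config N → ℂ) → Space → Space → ℂ
  | 0, _, _, _ => 0
  | n + 1, Ψ, x, y => (n + 1 : ℂ) * ∫ Y : Config n, Ψ (Matrix.vecCons x Y) * conj (Ψ (Matrix.vecCons y Y))

/-- For a real NONNEGATIVE `N`-body function (the ground state `Ψ₀`) the density matrix kernel is
the `[0, ∞]`-valued slice overlap: `γ(x, y) = N ∫ Ψ₀(x, Y) Ψ₀(y, Y) dY`, read back in `ℂ` (both
sides carry the same junk `0` when the overlap is infinite). Combined with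
`sqrt_oneParticleDensity_mul_affinity_palmMeasure`: `γ(x, y) = √(ρ(x)ρ(y)) · A(Pₓ, P_y)`.
[cite: LSSY2005, §1.2 (1.17)] -/
theorem densityMatrix_ofReal_eq {Ψ₀ : Config (n + 1) → ℝ} (hm : Measurable Ψ₀)
    (h0 : ∀ X, 0 ≤ Ψ₀ X) (x y : Space) :
    densityMatrix (n + 1) (fun X => (Ψ₀ X : ℂ)) x y =
      (((n + 1 : ℝ≥0∞) * ∫⁻ Y, (‖(Ψ₀ (Matrix.vecCons x Y) : ℂ)‖₊ : ℝ≥0∞) *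
        ‖(Ψ₀ (Matrix.vecCons y Y) : ℂ)‖₊).toReal : ℂ) := by
  simp only [densityMatrix]
  have h1 : ∀ Y : Config n, (Ψ₀ (Matrix.vecCons x Y) : ℂ) * conj (Ψ₀ (Matrix.vecCons y Y) : ℂ) =
      ((Ψ₀ (Matrix.vecCons x Y) * Ψ₀ (Matrix.vecCons y Y) : ℝ) : ℂ) := by
    intro Y
    rw [Complex.conj_ofReal, Complex.ofReal_mul]
  simp_rw [h1]
  rw [integral_complex_ofReal (f := fun Y => Ψ₀ (Matrix.vecCons x Y) * Ψ₀ (Matrix.vecCons y Y)),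
    integral_eq_lintegral_of_nonneg_ae
    (Eventually.of_forall fun Y => mul_nonneg (h0 _) (h0 _))
    (((hm.comp (measurable_vecCons_right x)).mul (hm.comp (measurable_vecCons_right y))).aestronglyMeasurable)]
  have h2 : ∀ Y : Config n, ENNReal.ofReal (Ψ₀ (Matrix.vecCons x Y) * Ψ₀ (Matrix.vecCons y Y)) =
      (‖(Ψ₀ (Matrix.vecCons x Y) : ℂ)‖₊ : ℝ≥0∞) * ‖(Ψ₀ (Matrix.vecCons y Y) : ℂ)‖₊ := by
    intro Y
    rw [ENNReal.ofReal_mul (h0 _), Complex.nnnorm_real, Complex.nnnorm_real, ← enorm_eq_nnnorm,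
      ← enorm_eq_nnnorm, Real.enorm_eq_ofReal (h0 _), Real.enorm_eq_ofReal (h0 _)]
  simp_rw [h2]
  have h3 : ((n + 1 : ℝ≥0∞)).toReal = (n + 1 : ℝ) := by
    rw [← Nat.cast_add_one, ENNReal.toReal_natCast, Nat.cast_add_one]
  rw [ENNReal.toReal_mul, h3, Complex.ofReal_mul, Complex.ofReal_add, Complex.ofReal_natCast,
    Complex.ofReal_one]

end DensityMatrix

end Literature.MathematicalPhysics.QuantumManyBody.BoseGas

end
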